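import Literature.NumberTheory.Congruences.JacobsthalWeakBinomialCongruence
import Literature.Combinatorics.Enumerative.AperyGaussCongruences
import Mathlib.NumberTheory.Padics.PadicVal.Basic
import Mathlib.Data.Nat.Choose.Central
import Mathlib.Tactic
import HarnessLib

/-!
# Osburn–Sahu–Straub 2016, Theorem 1.3 — I: super-Catalan integrality and the unit-ratio calculus

Topic `Literature/Combinatorics/Enumerative`, namespace `Literature.Combinatorics.Enumerative.SporadicS18Proofs`
(files `SporadicS18RatioProofs` → `SporadicS18TermProofs` → `SporadicS18Proofs`, the last proving the named fact
`AperyGaussCongruences.oss2016_theorem13`: «for any integers `m, r ≥ 1` and any primes `p`,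
`s₁₈(mp^r) ≡ s₁₈(mp^{r−1}) (mod p^{2r})`» for Cooper's sporadic sequence (7)
`s₁₈(n) = Σ_k (−1)^k C(n,k) C(2k,k) C(2(n−k),n−k) [C(2n−3k−1,n) + C(2n−3k,n)]`). Everything here is PROVED
(theorems only; no definitions, no named facts). HONEST FRAMING (cell pub-zeta5, D2 lens): a classical supercongruence
for a sporadic Apéry-like sequence; nothing about `ζ(5)` or any irrationality statement.

We follow the PRINTED proof [OsburnSahuStraub2016, §2, proof of Theorem 1.3] (held text `paper:arxiv-1312.2195`):
«`C(2k,k) C(2(n−k),n−k) = C(n,k) S(n−k,k)`, where `S(m,n) = (2m)!(2n)!/(m!n!(m+n)!)` are the super Catalan numbers …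
we only need that `S(n−k,k)` is an integer»; «denote the summand by `𝒟(n,k)` … `𝒟(mp^r, kp^s) ≡ 𝒟(mp^{r−1}, kp^{s−1})`
[by] a direct application of Lemma [Jacobsthal] … `C(2n−3k−1,n) = (−1)^n C(3k−n,n)` … for integers `k` such that
`p ∤ k`, `𝒟(mp^r, k) ≡ 0 (mod p^{2r})` … an immediate consequence of the fact that `𝒟(n,k)` is divisible by
`C(n,k)²`»; and the `p = 3` / `p = 2` paragraphs («congruence (41) only holds modulo `p^{r+s+min(r,s)−1}` … the
counterpart … `≡ ε (mod 2^{r+s+min(r,s)−2})`»), whose inputs are the tree's `JacobsthalWeak.exists_ratio_odd` /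
`exists_ratio_two` ([Straub2014] (41) at `p = 3` and `p = 2`).

This file: (1) `choose_add_dvd_centralBinom_mul` — super-Catalan integrality `C(m+n,m) ∣ C(2m,m) C(2n,n)` by the
recurrences `(n+1)C(2n+2,n+1) = 2(2n+1)C(2n,n)` (no definition of `S` is introduced); (2) the UNIT-RATIO CALCULUS used
to multiply instances of (41): a relation «`y·A = x·B`, `p ∤ y`, `p^m ∣ x − ε y`» is closed under products (`ratio_mul`)
and yields `p^{m+v} ∣ A − εB` when `p^v ∣ B` (`pow_dvd_sub_of_ratio`); (3) `exists_ratio_prime` — (41) for EVERY prime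
in one statement (modulus `p^{e+v_p(a)+v_p(b)+v_p(a−b)}`, `e = 1` for `p = 2`, `e = 2` otherwise; sign `ε = −1` iff
`p = 2`, `a` even, `b` odd), and the instance for the sum `C(ap−1,bp) + C(ap,bp)` over `C(a−1,b) + C(a,b)` (absorption
identity `C(M−1,N)·M = C(M,N)·(M−N)` — instead of the printed reflection `C(2n−3k−1,n) = (−1)^n C(3k−n,n)`), needed
for the factor `C(2n−3k−1,n) + C(2n−3k,n)`.

References: [OsburnSahuStraub2016] Theorem 1.3 and §2; [Straub2014] Lemma 5.1 (41).
-/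

open Finset

namespace Literature.Combinatorics.Enumerative.SporadicS18Proofs

/-! ### §1. Super-Catalan integrality -/

/-- **Super-Catalan integrality** (as used in [OsburnSahuStraub2016] §2: «`C(2k,k)C(2(n−k),n−k) = C(n,k) S(n−k,k)` … we
only need that `S(n−k,k)` is an integer»): `C(m+n, m) ∣ C(2m, m) · C(2n, n)`. Induction on `n` from
`(n+1)C(2n+2,n+1) = 2(2n+1)C(2n,n)`, `(m+n+1)C(m+n,m) = (n+1)C(m+n+1,m) = (m+1)C(m+n+1,m+1)`, which give
`C(2m,m)C(2n+2,n+1) = C(m+n+1,m)·(4u − w)` for `C(2m,m)C(2n,n) = C(m+n,m)u`, `C(2m+2,m+1)C(2n,n) = C(m+n+1,m+1)w`.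
[cite: OsburnSahuStraub2016, §2 (proof of Theorem 1.3: the super Catalan numbers are integers)] -/
theorem choose_add_dvd_centralBinom_mul (m n : ℕ) : (m + n).choose m ∣ (2 * m).choose m * (2 * n).choose n := by
  induction n generalizing m with
  | zero => simp
  | succ n ih =>
    obtain ⟨u, hu⟩ := ih m
    obtain ⟨w, hw⟩ := ih (m + 1)
    rw [show m + 1 + n = m + n + 1 by ring] at hw
    have h1 := Nat.succ_mul_centralBinom_succ n
    have h2 := Nat.succ_mul_centralBinom_succ m
    simp only [Nat.centralBinom_eq_two_mul_choose] at h1 h2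
    have h3 : (m + n + 1) * (m + n).choose m = (n + 1) * (m + n + 1).choose m := by
      have h := Nat.add_one_mul_choose_eq (m + n) n
      have hs1 : (m + n).choose n = (m + n).choose m := (Nat.choose_symm_add (a := m) (b := n)).symm
      have hs2 : (m + n + 1).choose (n + 1) = (m + n + 1).choose m := by
        have := Nat.choose_symm_add (a := m) (b := n + 1)
        rw [show m + (n + 1) = m + n + 1 by ring] at this
        exact this.symm
      rw [hs1, hs2] at h
      rw [h, mul_comm]
    have h4 : (m + 1) * (m + n + 1).choose (m + 1) = (n + 1) * (m + n + 1).choose m := by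
      have h := Nat.choose_succ_right_eq (m + n + 1) m
      rw [show m + n + 1 - m = n + 1 by omega] at h
      rw [mul_comm, h, mul_comm]
    have e1 : ((n : ℤ) + 1) * ((2 * (n + 1)).choose (n + 1) : ℕ) = 2 * (2 * n + 1) * ((2 * n).choose n : ℕ) := by
      exact_mod_cast h1
    have e2 : ((m : ℤ) + 1) * ((2 * (m + 1)).choose (m + 1) : ℕ) = 2 * (2 * m + 1) * ((2 * m).choose m : ℕ) := by
      exact_mod_cast h2
    have e3 : ((m : ℤ) + n + 1) * ((m + n).choose m : ℕ) = ((n : ℤ) + 1) * ((m + n + 1).choose m : ℕ) := by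
      exact_mod_cast h3
    have e4 : ((m : ℤ) + 1) * ((m + n + 1).choose (m + 1) : ℕ) = ((n : ℤ) + 1) * ((m + n + 1).choose m : ℕ) := by
      exact_mod_cast h4
    have eu : (((2 * m).choose m : ℕ) : ℤ) * ((2 * n).choose n : ℕ) = ((m + n).choose m : ℕ) * (u : ℤ) := by
      exact_mod_cast hu
    have ew : (((2 * (m + 1)).choose (m + 1) : ℕ) : ℤ) * ((2 * n).choose n : ℕ) =
        ((m + n + 1).choose (m + 1) : ℕ) * (w : ℤ) := by
      exact_mod_cast hw
    have key : ((n : ℤ) + 1) * ((((2 * m).choose m : ℕ) : ℤ) * ((2 * (n + 1)).choose (n + 1) : ℕ)) =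
        ((n : ℤ) + 1) * (((m + n + 1).choose m : ℕ) * (4 * (u : ℤ) - w)) := by
      linear_combination (((2 * m).choose m : ℕ) : ℤ) * e1 + (2 * (2 * (n : ℤ) + 1) + 2 * (2 * (m : ℤ) + 1)) * eu +
        4 * (u : ℤ) * e3 - (w : ℤ) * e4 + (((2 * n).choose n : ℕ) : ℤ) * e2 - ((m : ℤ) + 1) * ew
    have hn : ((n : ℤ) + 1) ≠ 0 := by positivity
    have key' := mul_left_cancel₀ hn key
    have hdvd : (((m + n + 1).choose m : ℕ) : ℤ) ∣ (((2 * m).choose m * (2 * (n + 1)).choose (n + 1) : ℕ) : ℤ) :=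
      ⟨4 * (u : ℤ) - w, by push_cast; rw [key']⟩
    rw [show m + (n + 1) = m + n + 1 by ring]
    exact Int.natCast_dvd_natCast.mp hdvd

/-- `C(n,k) ∣ C(2k,k)·C(2(n−k),n−k)` for `k ≤ n` (the form used for the summand of `s₁₈`).
[cite: OsburnSahuStraub2016, §2 (proof of Theorem 1.3: 𝒟(n,k) is divisible by C(n,k)²)] -/
theorem choose_dvd_centralBinom_mul {n k : ℕ} (hk : k ≤ n) :
    n.choose k ∣ (2 * k).choose k * (2 * (n - k)).choose (n - k) := by
  have h := choose_add_dvd_centralBinom_mul k (n - k)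
  rwa [Nat.add_sub_cancel' hk] at h

/-! ### §2. Valuations of binomial coefficients -/

/-- `v_p(C(N,K)) + v_p(K) ≥ v_p(N)` for `1 ≤ K ≤ N` (from `K·C(N,K) = N·C(N−1,K−1)`); in particular `p^{v_p(N)} ∣ C(N,K)`
when `p ∤ K` — «`C(mp^r, k)` … is divisible by `p^r` if `p ∤ k`». [cite: OsburnSahuStraub2016, §2 (eq. (23))] -/
theorem padicValNat_le_choose_add {p : ℕ} [hp : Fact p.Prime] {N K : ℕ} (hK : 1 ≤ K) (hKN : K ≤ N) :
    padicValNat p N ≤ padicValNat p (N.choose K) + padicValNat p K := by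
  have hid : N * (N - 1).choose (K - 1) = N.choose K * K := by
    have h := Nat.add_one_mul_choose_eq (N - 1) (K - 1)
    rwa [Nat.sub_add_cancel (by omega : 1 ≤ N), Nat.sub_add_cancel hK] at h
  have hC : N.choose K ≠ 0 := (Nat.choose_pos hKN).ne'
  have hK0 : K ≠ 0 := by omega
  rw [← padicValNat.mul hC hK0, ← hid, padicValNat.mul (by omega) (Nat.choose_pos (by omega)).ne']
  omega

/-- `min(v_p(a), v_p(b)) ≤ v_p(a − b)` for naturals `b < a` (with Mathlib's `v_p(0) = 0` the hypothesis `b < a` keeps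
`a − b ≠ 0`; for `b = 0` the claim is trivial) — the valuation bookkeeping of the printed proof.
[cite: OsburnSahuStraub2016, §2 (proof of Theorem 1.3, valuations)] -/
theorem min_padicValNat_le_sub {p : ℕ} [hp : Fact p.Prime] {a b : ℕ} (hba : b < a) :
    min (padicValNat p a) (padicValNat p b) ≤ padicValNat p (a - b) := by
  rcases Nat.eq_zero_or_pos b with hb | hb
  · subst hb; simp
  have ha : a ≠ 0 := by omega
  set m := min (padicValNat p a) (padicValNat p b) with hm
  have h1 : p ^ m ∣ a := (pow_dvd_pow p (min_le_left _ _)).trans pow_padicValNat_dvd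
  have h2 : p ^ m ∣ b := (pow_dvd_pow p (min_le_right _ _)).trans pow_padicValNat_dvd
  exact (padicValNat_dvd_iff_le (by omega)).mp (Nat.dvd_sub h1 h2)

/-! ### §3. The unit-ratio calculus -/

/-- **Products of unit ratios**: if `y₁A₁ = x₁B₁`, `y₂A₂ = x₂B₂` with `p ∤ y₁y₂` and `p^m ∣ x_i − ε_i y_i`, then
`(y₁y₂)(A₁A₂) = (x₁x₂)(B₁B₂)` and `p^m ∣ x₁x₂ − ε₁ε₂ y₁y₂` (the way the printed proof multiplies instances of (41) for
the factors of `𝒟(n,k)`). [cite: OsburnSahuStraub2016, §2 (proof of Theorem 1.3, «proceeding as in the proof of Lemma 2.4»)] -/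
theorem ratio_mul {p : ℕ} (hp : p.Prime) {m : ℕ} {ε₁ ε₂ A₁ B₁ A₂ B₂ : ℤ}
    (h₁ : ∃ x y : ℕ, ¬ p ∣ y ∧ (y : ℤ) * A₁ = x * B₁ ∧ (p : ℤ) ^ m ∣ (x : ℤ) - ε₁ * y)
    (h₂ : ∃ x y : ℕ, ¬ p ∣ y ∧ (y : ℤ) * A₂ = x * B₂ ∧ (p : ℤ) ^ m ∣ (x : ℤ) - ε₂ * y) :
    ∃ x y : ℕ, ¬ p ∣ y ∧ (y : ℤ) * (A₁ * A₂) = x * (B₁ * B₂) ∧ (p : ℤ) ^ m ∣ (x : ℤ) - ε₁ * ε₂ * y := by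
  obtain ⟨x₁, y₁, hy₁, hA₁, hm₁⟩ := h₁
  obtain ⟨x₂, y₂, hy₂, hA₂, hm₂⟩ := h₂
  refine ⟨x₁ * x₂, y₁ * y₂, fun h => ?_, ?_, ?_⟩
  · rcases (Nat.Prime.dvd_mul hp).mp h with h | h
    · exact hy₁ h
    · exact hy₂ h
  · push_cast
    linear_combination (y₂ : ℤ) * A₂ * hA₁ + (x₁ : ℤ) * B₁ * hA₂
  · push_cast
    rw [show ((x₁ : ℤ) * x₂) - ε₁ * ε₂ * (y₁ * y₂) = ((x₁ : ℤ) - ε₁ * y₁) * x₂ + ε₁ * y₁ * ((x₂ : ℤ) - ε₂ * y₂) by ring]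
    exact dvd_add (hm₁.mul_right _) (hm₂.mul_left _)

/-- Weakening the modulus of a unit ratio. [cite: OsburnSahuStraub2016, §2 (proof of Theorem 1.3, unit ratios)] -/
theorem ratio_mono {p : ℕ} {m m' : ℕ} (hmm : m ≤ m') {ε A B : ℤ}
    (h : ∃ x y : ℕ, ¬ p ∣ y ∧ (y : ℤ) * A = x * B ∧ (p : ℤ) ^ m' ∣ (x : ℤ) - ε * y) :
    ∃ x y : ℕ, ¬ p ∣ y ∧ (y : ℤ) * A = x * B ∧ (p : ℤ) ^ m ∣ (x : ℤ) - ε * y := by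
  obtain ⟨x, y, hy, hA, hm⟩ := h
  exact ⟨x, y, hy, hA, (pow_dvd_pow _ hmm).trans hm⟩

/-- The trivial unit ratio `A/A = 1` (any modulus). [cite: OsburnSahuStraub2016, §2 (proof of Theorem 1.3, unit ratios)] -/
theorem ratio_refl (p : ℕ) (hp : p.Prime) (m : ℕ) (A : ℤ) :
    ∃ x y : ℕ, ¬ p ∣ y ∧ (y : ℤ) * A = x * A ∧ (p : ℤ) ^ m ∣ (x : ℤ) - 1 * y :=
  ⟨1, 1, fun h => hp.one_lt.ne' (Nat.eq_one_of_dvd_one h), by simp, by simp⟩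

/-- **From a unit ratio to a congruence**: if `yA = xB`, `p ∤ y`, `p^m ∣ x − εy` and `p^v ∣ B`, then `p^{m+v} ∣ A − εB`
(«hence, applying the same arguments … shows that `𝒟(2^r m, 2^s k) = λ 𝒟(2^{r−1}m, 2^{s−1}k)` with `λ ≡ ±1` …; moreover,
both sides are divisible by …»). [cite: OsburnSahuStraub2016, §2 (proof of Theorem 1.3)] -/
theorem pow_dvd_sub_of_ratio {p : ℕ} (hp : p.Prime) {m v : ℕ} {ε A B : ℤ}
    (h : ∃ x y : ℕ, ¬ p ∣ y ∧ (y : ℤ) * A = x * B ∧ (p : ℤ) ^ m ∣ (x : ℤ) - ε * y) (hv : (p : ℤ) ^ v ∣ B) :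
    (p : ℤ) ^ (m + v) ∣ A - ε * B := by
  obtain ⟨x, y, hy, hA, hm⟩ := h
  have hid : (y : ℤ) * (A - ε * B) = ((x : ℤ) - ε * y) * B := by linear_combination hA
  have h12 : (p : ℤ) ^ (m + v) ∣ (y : ℤ) * (A - ε * B) := by
    rw [hid, pow_add]
    exact mul_dvd_mul hm hv
  have hcop : IsCoprime ((p : ℤ) ^ (m + v)) (y : ℤ) := by
    have hc : Nat.Coprime (p ^ (m + v)) y := Nat.Coprime.pow_left _ ((Nat.Prime.coprime_iff_not_dvd hp).mpr hy)
    have := Nat.isCoprime_iff_coprime.mpr hc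
    push_cast at this
    exact this
  exact hcop.dvd_of_dvd_mul_left h12

/-! ### §4. (41) for every prime, and the absorbed instance -/

/-- **[Straub2014] (41) for every prime `p`** (the tree's `JacobsthalWeak.exists_ratio_odd` for odd `p` — one power short
of Jacobsthal's for `p ≥ 5`, which suffices here — and `exists_ratio_two`), as one unit ratio: for `b ≤ a`,
`y·C(ap,bp) = x·C(a,b)`, `p ∤ y`, `p^{e + v_p(a) + v_p(b) + v_p(a−b)} ∣ x − εy` with `e = 1` if `p = 2` and `e = 2`
otherwise, `ε = −1` iff `p = 2`, `a` even, `b` odd. [cite: Straub2014, Lemma 5.1 (41)]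
[cite: OsburnSahuStraub2016, §2 (proof of Theorem 1.3, the cases p = 3 and p = 2)] -/
theorem exists_ratio_prime (p : ℕ) [hp : Fact p.Prime] {a b : ℕ} (hab : b ≤ a) :
    ∃ x y : ℕ, ¬ p ∣ y ∧ (y : ℤ) * (((a * p).choose (b * p) : ℕ) : ℤ) = x * ((a.choose b : ℕ) : ℤ) ∧
      (p : ℤ) ^ ((if p = 2 then 1 else 2) + padicValNat p a + padicValNat p b + padicValNat p (a - b)) ∣
        (x : ℤ) - (if p = 2 ∧ Even a ∧ ¬ Even b then -1 else 1) * y := by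
  by_cases hp2 : p = 2
  · subst hp2
    obtain ⟨x, y, hy, hxy, hmod⟩ := Literature.NumberTheory.Congruences.JacobsthalWeak.exists_ratio_two hab
    refine ⟨x, y, hy, by exact_mod_cast hxy, ?_⟩
    rw [if_pos rfl]
    have h := Int.modEq_iff_dvd.mp hmod.symm
    have e : ((2 : ℕ) : ℤ) = 2 := by norm_num
    have hε : (if (2 = 2 ∧ Even a ∧ ¬ Even b) then (-1 : ℤ) else 1) * (y : ℤ) =
        (if Even a ∧ ¬ Even b then -(y : ℤ) else y) := by
      by_cases hc : Even a ∧ ¬ Even b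
      · rw [if_pos ⟨rfl, hc⟩, if_pos hc]; ring
      · rw [if_neg (fun h => hc h.2), if_neg hc]; ring
    rw [e, hε]
    exact h
  · obtain ⟨x, y, hy, hxy, hmod⟩ := Literature.NumberTheory.Congruences.JacobsthalWeak.exists_ratio_odd (p := p) hp2 a b
    refine ⟨x, y, hy, by exact_mod_cast hxy, ?_⟩
    rw [if_neg hp2, if_neg (fun h => hp2 h.1), one_mul]
    have h := Nat.modEq_iff_dvd.mp hmod.symm
    push_cast at h
    exact h

/-- **The absorbed instance** for the factor `C(2n−3k−1,n) + C(2n−3k,n)` of `𝒟(n,k)`: with `M = 2n' − 3k' ≥ n' ≥ 1`,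
`N = n'`, the SAME unit ratio `x/y` of (41) for `C(Mp,Np)/C(M,N)` also carries `C(Mp−1,Np) + C(Mp,Np)` over
`C(M−1,N) + C(M,N)`, because `C(L−1,N)·L = C(L,N)·(L−N)` at `L = Mp` and `L = M` give
`M·[C(Mp−1,Np) + C(Mp,Np)] = C(Mp,Np)·(2M−N)` and `M·[C(M−1,N) + C(M,N)] = C(M,N)·(2M−N)` (this replaces the printed
reflection `C(2n−3k−1,n) = (−1)^n C(3k−n,n)`). [cite: OsburnSahuStraub2016, §2 (proof of Theorem 1.3, the factor C(2mp^r−3kp^s−1, mp^r))] -/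
theorem exists_ratio_prime_absorbed (p : ℕ) [hp : Fact p.Prime] {M N : ℕ} (hNM : N ≤ M) (hM : 1 ≤ M) :
    ∃ x y : ℕ, ¬ p ∣ y ∧
      (y : ℤ) * (((M * p - 1).choose (N * p) + (M * p).choose (N * p) : ℕ) : ℤ) =
        x * (((M - 1).choose N + M.choose N : ℕ) : ℤ) ∧
      (p : ℤ) ^ ((if p = 2 then 1 else 2) + padicValNat p M + padicValNat p N + padicValNat p (M - N)) ∣
        (x : ℤ) - (if p = 2 ∧ Even M ∧ ¬ Even N then -1 else 1) * y := by
  have hp' := hp.out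
  obtain ⟨x, y, hy, hxy, hmod⟩ := exists_ratio_prime p hNM
  refine ⟨x, y, hy, ?_, hmod⟩
  -- absorption identities
  have hMp : 1 ≤ M * p := Nat.one_le_iff_ne_zero.mpr (Nat.mul_ne_zero (by omega) hp'.ne_zero)
  have a1 : (M * p - 1).choose (N * p) * (M * p) = (M * p).choose (N * p) * (M * p - N * p) := by
    have h := Nat.choose_mul_succ_eq (M * p - 1) (N * p)
    rwa [Nat.sub_add_cancel hMp] at h
  have a2 : (M - 1).choose N * M = M.choose N * (M - N) := by
    have h := Nat.choose_mul_succ_eq (M - 1) N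
    rwa [Nat.sub_add_cancel hM] at h
  -- multiply the wanted identity by `M p > 0` and compare
  have hMz : ((M : ℤ) * p) ≠ 0 := by exact_mod_cast (show M * p ≠ 0 by omega)
  apply mul_left_cancel₀ hMz
  have e1 : (((M * p - 1).choose (N * p) : ℕ) : ℤ) * ((M : ℤ) * p) =
      (((M * p).choose (N * p) : ℕ) : ℤ) * ((M : ℤ) * p - N * p) := by
    have h := congrArg (Nat.cast : ℕ → ℤ) a1
    push_cast [Nat.cast_sub (Nat.mul_le_mul_right p hNM)] at h
    exact h
  have e2 : (((M - 1).choose N : ℕ) : ℤ) * (M : ℤ) = ((M.choose N : ℕ) : ℤ) * ((M : ℤ) - N) := by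
    have h := congrArg (Nat.cast : ℕ → ℤ) a2
    push_cast [Nat.cast_sub hNM] at h
    exact h
  push_cast
  linear_combination (y : ℤ) * e1 - (x : ℤ) * (p : ℤ) * e2 + (2 * (M : ℤ) - N) * (p : ℤ) * hxy

end Literature.Combinatorics.Enumerative.SporadicS18Proofs
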